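import Summits.CriticalPhenomena.PercolationContinuityZ3.Theorems.Transplant.SkelPhiKitsAStepIV
import Summits.CriticalPhenomena.PercolationContinuityZ3.Theorems.Transplant.SkelPhiAffinePlacement
import Summits.CriticalPhenomena.PercolationContinuityZ3.Theorems.Transplant.SkelPhiRunQSteps
import HarnessLib

/-!
# N1 (the `{±1}` node), LEVEL 1, kit adapter file N-K6d: **THE KIT CLAUSE OF AN x-RUN / y′-RUN WINDOW LEVEL** — `kitClauseA'` at the run
# frame `runX φ c₀ n_L h_L σ` (resp. `runY`): quasi-steps `qStepsN_runX` (`N = kq + 3`), Lipschitz `lip_runX`, side forms `runXSideU`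
# (affine of slope `U_L = n_L + |h_L|`), `compat_runX`; the seven placement hypotheses from four numbers (`SkelPhiAffinePlacement`); the
# exit pieces: x-family side half through raw sides, y-family top/bottom piece through level sides (`SkelPhiRunExitPieces`)

builds on p205010 (kernel theorem, internal audit signed; external expert review pending) — nothing in this file uses p205010; nothing here is a
claim about the open node `SamePDropOfSkeletonNeg`.
Lane `prim-bschramm`, seat `prim-bschramm-p1` (gen 11; design KIT-APRON-N1); helper file (`--supports stmt-CriticalPhenomena-4575 --as helper`).
* `ShortPc` (the short piece data drawn at a centre), `pexX`, `pexY` (the exit pieces per side), `pexX_spec`, `pexY_spec`;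
* **`kitClause_runX`**, **`kitClause_runY`**.
[cite: KozmaNitzan2024, §4 Lemma 10, Steps III–IV (pp. 19–21)] [cite: MartineauTassion2017, §3]
-/

noncomputable section

open scoped Classical

namespace Summit.CriticalPhenomena.PercolationContinuityZ3.Theorems.Transplant

namespace Skelφ

open MeasureTheory
open Literature.Probability.Percolation Literature.Probability.LatticeModels SimpleGraph KNLevels
open Literature.Barriers.CriticalPhenomena (graphBall graphBall_finite mem_graphBall_self graphBall_mono)
open Skel (winGraph winGraph_adj winGraph_le KitGeom)
open SkelI (tanOff tanTgt tanTgt_mem)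
open Literature.Probability.Percolation.KozmaNitzan.Cells (oth oth_ne eq_oth_of_ne oth_oth)

variable {V : Type} [DecidableEq V] {G : SimpleGraph V} [G.LocallyFinite] {φ : V → Site 2}

/-- **The short piece data drawn at a centre** (width, shear, half-length, prism radius, split point — functions of the centre through its
frame type). [cite: MartineauTassion2017, §3.2] -/
structure ShortPc (V : Type) where
  /-- width -/
  nS : V → ℕ
  /-- shear -/
  hS : V → ℤ
  /-- half-length -/
  ℓS : V → ℕ
  /-- prism radius -/
  RS : V → ℕ
  /-- split point -/
  vS : V → ℤ

variable (G φ) in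
/-- **The exit pieces of an x-run level kit**: raw sides (`i = 0`) — the outward side half; level sides (`i = 1`) — the outward top/bottom piece. -/
def pexX (Q : ShortPc V) (σ : ℤ) (i : Fin 2) (σ₀ : ℤˣ) (c : V) : Finset V :=
  if i = 0 then pgSideHalfW G φ c (Q.nS c) (Q.hS c) (Q.ℓS c) (Q.RS c) ((σ₀ : ℤ) * σ) 1
  else pgTopPieceW G φ c (Q.nS c) (Q.hS c) (Q.ℓS c) (Q.RS c) ((σ₀ : ℤ) * σ) 1 (Q.vS c)

variable (G φ) in
/-- **The exit pieces of a y′-run level kit** (coordinates exchanged). -/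
def pexY (Q : ShortPc V) (σ : ℤ) (i : Fin 2) (σ₀ : ℤˣ) (c : V) : Finset V :=
  if i = 0 then pgTopPieceW G φ c (Q.nS c) (Q.hS c) (Q.ℓS c) (Q.RS c) ((σ₀ : ℤ) * σ) 1 (Q.vS c)
  else pgSideHalfW G φ c (Q.nS c) (Q.hS c) (Q.ℓS c) (Q.RS c) ((σ₀ : ℤ) * σ) 1

omit [DecidableEq V] in
/-- **The exit pieces of an x-run kit lie below the shell lines** (raw: `nz + 3 ≤ n_s`; level: the slope-mismatch inequality). [this work] -/
theorem pexX_spec (c₀ : V) {nL : ℕ} (hnL : 1 ≤ nL) (hL : ℤ) {σ : ℤ} (hσ : σ = 1 ∨ σ = -1) (Lo Hi : Site 2) (Q : ShortPc V) {A : ℤ} {nz : ℕ}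
    (hA : A = (nz + 1 : ℕ) * (shearUnit nL hL : ℤ) + 1) (hnS : ∀ c, 1 ≤ Q.nS c) (hexRaw : ∀ c, nz + 3 ≤ Q.nS c)
    (hexLev : ∀ c, (A + nL) * Q.nS c ≤ (nL : ℤ) * ((Q.nS c : ℤ) * Q.ℓS c - shearUnit (Q.nS c) (Q.hS c) + 1) - |(nL : ℤ) * Q.hS c - hL * Q.nS c| * Q.nS c)
    (i : Fin 2) (σ₀ : ℤˣ) (c : V) : ∀ v ∈ pexX G φ Q σ i σ₀ c,
      (runXSideU (φ := φ) c₀ hnL hL hσ Lo Hi i σ₀).lin (φ v) + A +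
        ((runXSideU (φ := φ) c₀ hnL hL hσ Lo Hi i σ₀).s : ℤ) * coef (runXSideU (φ := φ) c₀ hnL hL hσ Lo Hi i σ₀).cα
          (runXSideU (φ := φ) c₀ hnL hL hσ Lo Hi i σ₀).cβ (runXSideU (φ := φ) c₀ hnL hL hσ Lo Hi i σ₀).a ≤
      (runXSideU (φ := φ) c₀ hnL hL hσ Lo Hi i σ₀).lin (φ c) := by
  intro v hv
  have hU1 : (1 : ℤ) ≤ (shearUnit nL hL : ℤ) := by have := shearUnit_pos hnL hL; omega
  fin_cases i <;> simp only [Fin.zero_eta, Fin.isValue, Fin.mk_one] at hv ⊢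
  · simp only [pexX, if_true] at hv
    have hA' : A + (shearUnit nL hL : ℤ) ≤ (shearUnit nL hL : ℤ) * Q.nS c := by
      rw [hA]; push_cast
      have h1 : ((nz : ℤ) + 3) ≤ Q.nS c := by exact_mod_cast hexRaw c
      nlinarith
    exact exit_rawSideU_sideHalf (ψ := runX φ c₀ nL hL σ) c₀ σ hσ hU1 Lo Hi 0 σ₀ (fun w => by rw [runX_zero, relCoord_apply]) hA' hv
  · simp only [pexX, show ¬ ((1 : Fin 2) = 0) by decide, if_false] at hv
    exact exit_levSide_topPiece (ψ := runX φ c₀ nL hL σ) c₀ hnL hL σ hσ Lo Hi 1 σ₀ (fun w => by rw [runX_one]) (hnS c) (hexLev c) hv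

omit [DecidableEq V] in
/-- **The exit pieces of a y′-run kit lie below the shell lines.** [this work] -/
theorem pexY_spec (c₀ : V) {nL : ℕ} (hnL : 1 ≤ nL) (hL : ℤ) {σ : ℤ} (hσ : σ = 1 ∨ σ = -1) (Lo Hi : Site 2) (Q : ShortPc V) {A : ℤ} {nz : ℕ}
    (hA : A = (nz + 1 : ℕ) * (shearUnit nL hL : ℤ) + 1) (hnS : ∀ c, 1 ≤ Q.nS c) (hexRaw : ∀ c, nz + 3 ≤ Q.nS c)
    (hexLev : ∀ c, (A + nL) * Q.nS c ≤ (nL : ℤ) * ((Q.nS c : ℤ) * Q.ℓS c - shearUnit (Q.nS c) (Q.hS c) + 1) - |(nL : ℤ) * Q.hS c - hL * Q.nS c| * Q.nS c)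
    (i : Fin 2) (σ₀ : ℤˣ) (c : V) : ∀ v ∈ pexY G φ Q σ i σ₀ c,
      (runYSideU (φ := φ) c₀ hnL hL hσ Lo Hi i σ₀).lin (φ v) + A +
        ((runYSideU (φ := φ) c₀ hnL hL hσ Lo Hi i σ₀).s : ℤ) * coef (runYSideU (φ := φ) c₀ hnL hL hσ Lo Hi i σ₀).cα
          (runYSideU (φ := φ) c₀ hnL hL hσ Lo Hi i σ₀).cβ (runYSideU (φ := φ) c₀ hnL hL hσ Lo Hi i σ₀).a ≤
      (runYSideU (φ := φ) c₀ hnL hL hσ Lo Hi i σ₀).lin (φ c) := by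
  intro v hv
  have hU1 : (1 : ℤ) ≤ (shearUnit nL hL : ℤ) := by have := shearUnit_pos hnL hL; omega
  fin_cases i <;> simp only [Fin.zero_eta, Fin.isValue, Fin.mk_one] at hv ⊢
  · simp only [pexY, if_true] at hv
    exact exit_levSide_topPiece (ψ := runY φ c₀ nL hL σ) c₀ hnL hL σ hσ Lo Hi 0 σ₀ (fun w => by rw [runY_zero]) (hnS c) (hexLev c) hv
  · simp only [pexY, show ¬ ((1 : Fin 2) = 0) by decide, if_false] at hv
    have hA' : A + (shearUnit nL hL : ℤ) ≤ (shearUnit nL hL : ℤ) * Q.nS c := by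
      rw [hA]; push_cast
      have h1 : ((nz : ℤ) + 3) ≤ Q.nS c := by exact_mod_cast hexRaw c
      nlinarith
    exact exit_rawSideU_sideHalf (ψ := runY φ c₀ nL hL σ) c₀ σ hσ hU1 Lo Hi 1 σ₀ (fun w => by rw [runY_one, relCoord_apply]) hA' hv

/-- **THE KIT CLAUSE OF AN x-RUN WINDOW LEVEL.** Level box `[lo − j, hi + j]` of the frame `runX φ c₀ n_L h_L σ` around `w₀` (radius `R`);
kit constants `P` with the four placement numbers; short region `Rg`, zone family `Λc` (seed level `kz`, zone level `nz`), short piece data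
`Q` (pieces inside `Rg`, exit inequalities); per contact: far ⇒ inner neighbour in the target; near ⇒ a face vertex in the target or the
three Step-IV inputs at the kit centre (zone, the exit link of the side's piece, the route datum). [cite: KozmaNitzan2024, §4 Lemma 10] -/
theorem kitClause_runX [Countable V] {types : Finset V} (hlipφ : Lip G φ) (hstep : Steps G φ) (hfr : Frames G φ types) (hκ : CylConn G φ types)
    {Δ : ℕ} (hΔ : ∀ v, G.degree v ≤ Δ) {q : unitInterval} {δ : ℝ} (hδ : 0 < δ)
    -- the run frame
    {nL : ℕ} (hnL : 1 ≤ nL) (c₀ : V) (hL : ℤ) {σ : ℤ} (hσ : σ = 1 ∨ σ = -1) {kq : ℕ} (hκL : hL.natAbs ≤ kq * nL)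
    -- the level box and the window
    {lo hi : Site 2} {j : ℕ} {w₀ : V} {R : ℕ}
    -- kit constants
    (P : ApronPrm) {nz Rs Kmax KCmax rs cS cU : ℕ} (hPN : kq + 3 ≤ P.N) (hA : P.A = (nz + 1 : ℕ) * (shearUnit nL hL : ℤ) + 1)
    (hd1 : P.W + P.ℓ ≤ P.d) (hD1 : P.W + P.ℓ + P.d + 2 ≤ shellD P) (hD2 : P.ℓ + Rs + P.d + 3 ≤ shellD P) (hDρ : Rs + 1 ≤ shellD P)
    (hℓ : 1 ≤ P.ℓ) (hW : Rs + P.ℓ ≤ P.W) (hKmax : (shellD P + P.W) * (kq + 1) ≤ Kmax) (hKCmax : (shellD P + nz + 1) * (kq + 1) ≤ KCmax)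
    (hR' : cylRadMax G φ types P.ℓ (Rs + KCmax + (P.W + Kmax)) ≤ P.R')
    (hwide : ∀ i, (lo - (j : Site 2)) i + 2 * tanOff P.ℓs P.M ≤ (hi + (j : Site 2)) i)
    (hdw : ∀ i, (lo - (j : Site 2)) i + (P.d + 2 : ℕ) ≤ (hi + (j : Site 2)) i)
    (hDw : ∀ i, (lo - (j : Site 2)) i + ((shellD P + 1 + P.d + KCmax + Rs : ℕ) : ℤ) ≤ (hi + (j : Site 2)) i)
    (hT : (P.W : ℤ) + Kmax + P.ℓ + 1 ≤ tanOff P.ℓs P.M) (hT' : (shellD P : ℤ) + KCmax + Rs ≤ tanOff P.ℓs P.M)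
    (hr₀ : P.N * (tanOff P.ℓs P.M + 2) + P.N * P.d + (P.W + Kmax + P.R') + (KCmax + Rs) ≤ P.r₀) (hR : P.r₀ ≤ R)
    (hrs : 2 * (1 + P.N * (tanOff P.ℓs P.M + 2) + P.N * P.d + (P.W + Kmax + P.R') + (KCmax + Rs)) ≤ rs)
    (hcS : (P.N + 1) * (tanOff P.ℓs P.M + 1) + (P.N + 1) * P.d + (2 * P.W + 1) * (Kmax + 1) * (Δ + 1) ^ P.R' ≤ cS)
    -- the short region, the zone family, the short pieces
    (Rg : V → Finset V) (hRg : ∀ c, ∀ u ∈ Rg c, u ∈ graphBall G c Rs) (hRgcard : ∀ c, (Rg c).card ≤ cU) (hcU1 : 1 ≤ cU)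
    (Λc : V → ℕ → Finset V) (kz : ℕ) (hkn : ∀ c, Λc c kz ⊆ Λc c nz) (hΛ : ∀ c, ∀ v ∈ Λc c nz, v ∈ Rg c ∧ φ v - φ c ∈ box 2 nz)
    (Q : ShortPc V) (hQRg : ∀ i σ₀ c, pexX G φ Q σ i σ₀ c ⊆ Rg c) (hnS : ∀ c, 1 ≤ Q.nS c) (hexRaw : ∀ c, nz + 3 ≤ Q.nS c)
    (hexLev : ∀ c, (P.A + nL) * Q.nS c ≤
      (nL : ℤ) * ((Q.nS c : ℤ) * Q.ℓS c - shearUnit (Q.nS c) (Q.hS c) + 1) - |(nL : ℤ) * Q.hS c - hL * Q.nS c| * Q.nS c)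
    -- the level's source/support, the weighting, the region and the target
    (k : ℕ) (o : V) (Sfin : Finset V) {Wt : Sym2 V → unitInterval} {D T : Finset V} (hWD : IsSubbox (winGraph G w₀ R) Wt q D)
    (hXD : winLevel G (runX φ c₀ nL hL σ) w₀ R lo hi j ⊆ D) {N : ℕ} (hN : k * (Δ + 1) ^ (2 * rs) ≤ N)
    (hk : (1 - (q : ℝ) ^ (1 + Δ * cS + cS * cU)) ^ k ≤ δ)
    -- per contact
    (hfar : ∀ x ∈ outerBoundary (winGraph G w₀ R) (winLevel G (runX φ c₀ nL hL σ) w₀ R lo hi j),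
      ¬ IsNear G (runX φ c₀ nL hL σ) (lo - (j : Site 2)) (hi + (j : Site 2)) P w₀ R x →
      ctY G (runX φ c₀ nL hL σ) w₀ R (lo - (j : Site 2)) (hi + (j : Site 2)) x ∈ T)
    (hnear' : ∀ x ∈ outerBoundary (winGraph G w₀ R) (winLevel G (runX φ c₀ nL hL σ) w₀ R lo hi j),
      IsNear G (runX φ c₀ nL hL σ) (lo - (j : Site 2)) (hi + (j : Site 2)) P w₀ R x →
      (∃ u ∈ ctFace G (runXSideU (φ := φ) c₀ hnL hL hσ (lo - (j : Site 2)) (hi + (j : Site 2))) Rg P w₀ R x, u ∈ T) ∨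
      (1 - δ ^ 2 < (bondPercolation G q).real
          (UniqZone.zone G (Λc (ctCtr G (runXSideU (φ := φ) c₀ hnL hL hσ (lo - (j : Site 2)) (hi + (j : Site 2))) P w₀ R x)) kz nz) ∧
        1 - δ ^ 2 < (bondPercolation G q).real
          (linkIn (↑(Rg (ctCtr G (runXSideU (φ := φ) c₀ hnL hL hσ (lo - (j : Site 2)) (hi + (j : Site 2))) P w₀ R x)) : Set V)
            (Λc (ctCtr G (runXSideU (φ := φ) c₀ hnL hL hσ (lo - (j : Site 2)) (hi + (j : Site 2))) P w₀ R x) kz)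
            (pexX G φ Q σ (ctDir G (runX φ c₀ nL hL σ) w₀ R (lo - (j : Site 2)) (hi + (j : Site 2)) x).1
              (ctDir G (runX φ c₀ nL hL σ) w₀ R (lo - (j : Site 2)) (hi + (j : Site 2)) x).2
              (ctCtr G (runXSideU (φ := φ) c₀ hnL hL hσ (lo - (j : Site 2)) (hi + (j : Site 2))) P w₀ R x))) ∧
        ∃ Qt Ft : Finset V, Ft ⊆ T ∧ Qt ⊆ D ∧
          Disjoint Ft (Λc (ctCtr G (runXSideU (φ := φ) c₀ hnL hL hσ (lo - (j : Site 2)) (hi + (j : Site 2))) P w₀ R x) nz) ∧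
          1 - δ ^ 2 < (prodBernoulli Wt).real (linkIn (↑Qt : Set V)
            (Λc (ctCtr G (runXSideU (φ := φ) c₀ hnL hL hσ (lo - (j : Site 2)) (hi + (j : Site 2))) P w₀ R x) kz) Ft))) :
    ∃ (σ' : SData V) (S : Finset V), SHyp (winLData G (runX φ c₀ nL hL σ) w₀ R lo hi o Sfin) j σ' ∧ σ'.N ≤ N ∧
      (1 - (q : ℝ) ^ σ'.sB) ^ σ'.k ≤ δ ∧ S ⊆ (winLData G (runX φ c₀ nL hL σ) w₀ R lo hi o Sfin).X j ∧ S ⊆ D ∧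
      (∀ x ∈ σ'.K, ∀ e ∈ σ'.seed x, e ∉ wireSet (↑S : Set V)) ∧ (∀ x ∈ σ'.K, σ'.face x ⊆ S) ∧
      (∀ x ∈ σ'.K, 1 - 3 * δ ≤ (prodBernoulli Wt).real {ω | ∃ u ∈ σ'.face x,
        1 - δ < (prodBernoulli (pinW Wt (wireSet (↑S : Set V)) ω)).real (⋃ t ∈ T, openConnIn (↑D : Set V) u t)}) := by
  set SF := runXSideU (φ := φ) c₀ hnL hL hσ (lo - (j : Site 2)) (hi + (j : Site 2)) with hSF
  have hU1 : (1 : ℤ) ≤ (shearUnit nL hL : ℤ) := by have := shearUnit_pos hnL hL; omega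
  have hU : (shearUnit nL hL : ℤ) ≤ ((kq + 1 : ℕ) : ℤ) * nL := by
    unfold shearUnit; push_cast
    have : (hL.natAbs : ℤ) ≤ kq * nL := by exact_mod_cast hκL
    linarith
  have haff : ∀ (i : Fin 2) (σ₀ : ℤˣ), (SF i σ₀).IsAffine (shearUnit nL hL : ℤ) (if i = 0 then (shearUnit nL hL : ℤ) else nL) := fun i σ₀ => by
    rw [hSF]; exact runXSideU_isAffine c₀ hnL hL hσ _ _ i σ₀
  have hC : ∀ (i : Fin 2) (σ₀ : ℤˣ), (nL : ℤ) ≤ (if i = 0 then (shearUnit nL hL : ℤ) else nL) := fun i σ₀ => by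
    split_ifs
    · have : ((shearUnit nL hL : ℕ) : ℤ) = nL + (hL.natAbs : ℤ) := by unfold shearUnit; push_cast; ring
      rw [this]; linarith [Int.natCast_nonneg hL.natAbs]
    · exact le_rfl
  have hA0 : 0 ≤ P.A := by rw [hA]; positivity
  have hdD : P.d + 2 ≤ shellD P := by omega
  refine kitClauseA' SF Rg (lip_runX hlipφ hσ hnL c₀ hL) ((qStepsN_runX hstep hnL c₀ hL hσ hκL).mono hPN) hlipφ hstep hfr hκ hΔ hδ hℓ
    hwide hdw hdD hDw hDρ
    (hbelow_of_affine SF haff hU1 P hD1) (habove_of_affine SF haff hU1 P hd1) (hK_of_affine SF haff hU1 P hnL hC hU hKmax)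
    (fun i σ₀ z hz _ => hKC_of_affine SF haff hU1 P hnL hC hU hA hKCmax i σ₀ z hz) (hθA_of_affine SF haff hU1 P hA0 hdD) (hAz_of_affine SF haff P hA)
    (hcap_of_affine SF haff hU1 P hD2) (compat_runX hnL c₀ hL hσ) hT hT' hW hR' hRg hRgcard hcU1 hr₀ hR hrs hcS Λc hkn hΛ
    (pexX G φ Q σ) (fun i σ₀ c v hv => ⟨hQRg i σ₀ c hv, ?_⟩) k o Sfin hWD hXD hN hk hfar hnear'
  rw [hSF]
  exact pexX_spec c₀ hnL hL hσ _ _ Q hA hnS hexRaw hexLev i σ₀ c v hv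

/-- **THE KIT CLAUSE OF A y′-RUN WINDOW LEVEL** (coordinates exchanged). Level box `[lo − j, hi + j]` of the frame `runX φ c₀ n_L h_L σ` around `w₀` (radius `R`);
kit constants `P` with the four placement numbers; short region `Rg`, zone family `Λc` (seed level `kz`, zone level `nz`), short piece data
`Q` (pieces inside `Rg`, exit inequalities); per contact: far ⇒ inner neighbour in the target; near ⇒ a face vertex in the target or the
three Step-IV inputs at the kit centre (zone, the exit link of the side's piece, the route datum). [cite: KozmaNitzan2024, §4 Lemma 10] -/
theorem kitClause_runY [Countable V] {types : Finset V} (hlipφ : Lip G φ) (hstep : Steps G φ) (hfr : Frames G φ types) (hκ : CylConn G φ types)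
    {Δ : ℕ} (hΔ : ∀ v, G.degree v ≤ Δ) {q : unitInterval} {δ : ℝ} (hδ : 0 < δ)
    -- the run frame
    {nL : ℕ} (hnL : 1 ≤ nL) (c₀ : V) (hL : ℤ) {σ : ℤ} (hσ : σ = 1 ∨ σ = -1) {kq : ℕ} (hκL : hL.natAbs ≤ kq * nL)
    -- the level box and the window
    {lo hi : Site 2} {j : ℕ} {w₀ : V} {R : ℕ}
    -- kit constants
    (P : ApronPrm) {nz Rs Kmax KCmax rs cS cU : ℕ} (hPN : kq + 3 ≤ P.N) (hA : P.A = (nz + 1 : ℕ) * (shearUnit nL hL : ℤ) + 1)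
    (hd1 : P.W + P.ℓ ≤ P.d) (hD1 : P.W + P.ℓ + P.d + 2 ≤ shellD P) (hD2 : P.ℓ + Rs + P.d + 3 ≤ shellD P) (hDρ : Rs + 1 ≤ shellD P)
    (hℓ : 1 ≤ P.ℓ) (hW : Rs + P.ℓ ≤ P.W) (hKmax : (shellD P + P.W) * (kq + 1) ≤ Kmax) (hKCmax : (shellD P + nz + 1) * (kq + 1) ≤ KCmax)
    (hR' : cylRadMax G φ types P.ℓ (Rs + KCmax + (P.W + Kmax)) ≤ P.R')
    (hwide : ∀ i, (lo - (j : Site 2)) i + 2 * tanOff P.ℓs P.M ≤ (hi + (j : Site 2)) i)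
    (hdw : ∀ i, (lo - (j : Site 2)) i + (P.d + 2 : ℕ) ≤ (hi + (j : Site 2)) i)
    (hDw : ∀ i, (lo - (j : Site 2)) i + ((shellD P + 1 + P.d + KCmax + Rs : ℕ) : ℤ) ≤ (hi + (j : Site 2)) i)
    (hT : (P.W : ℤ) + Kmax + P.ℓ + 1 ≤ tanOff P.ℓs P.M) (hT' : (shellD P : ℤ) + KCmax + Rs ≤ tanOff P.ℓs P.M)
    (hr₀ : P.N * (tanOff P.ℓs P.M + 2) + P.N * P.d + (P.W + Kmax + P.R') + (KCmax + Rs) ≤ P.r₀) (hR : P.r₀ ≤ R)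
    (hrs : 2 * (1 + P.N * (tanOff P.ℓs P.M + 2) + P.N * P.d + (P.W + Kmax + P.R') + (KCmax + Rs)) ≤ rs)
    (hcS : (P.N + 1) * (tanOff P.ℓs P.M + 1) + (P.N + 1) * P.d + (2 * P.W + 1) * (Kmax + 1) * (Δ + 1) ^ P.R' ≤ cS)
    -- the short region, the zone family, the short pieces
    (Rg : V → Finset V) (hRg : ∀ c, ∀ u ∈ Rg c, u ∈ graphBall G c Rs) (hRgcard : ∀ c, (Rg c).card ≤ cU) (hcU1 : 1 ≤ cU)
    (Λc : V → ℕ → Finset V) (kz : ℕ) (hkn : ∀ c, Λc c kz ⊆ Λc c nz) (hΛ : ∀ c, ∀ v ∈ Λc c nz, v ∈ Rg c ∧ φ v - φ c ∈ box 2 nz)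
    (Q : ShortPc V) (hQRg : ∀ i σ₀ c, pexY G φ Q σ i σ₀ c ⊆ Rg c) (hnS : ∀ c, 1 ≤ Q.nS c) (hexRaw : ∀ c, nz + 3 ≤ Q.nS c)
    (hexLev : ∀ c, (P.A + nL) * Q.nS c ≤
      (nL : ℤ) * ((Q.nS c : ℤ) * Q.ℓS c - shearUnit (Q.nS c) (Q.hS c) + 1) - |(nL : ℤ) * Q.hS c - hL * Q.nS c| * Q.nS c)
    -- the level's source/support, the weighting, the region and the target
    (k : ℕ) (o : V) (Sfin : Finset V) {Wt : Sym2 V → unitInterval} {D T : Finset V} (hWD : IsSubbox (winGraph G w₀ R) Wt q D)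
    (hXD : winLevel G (runY φ c₀ nL hL σ) w₀ R lo hi j ⊆ D) {N : ℕ} (hN : k * (Δ + 1) ^ (2 * rs) ≤ N)
    (hk : (1 - (q : ℝ) ^ (1 + Δ * cS + cS * cU)) ^ k ≤ δ)
    -- per contact
    (hfar : ∀ x ∈ outerBoundary (winGraph G w₀ R) (winLevel G (runY φ c₀ nL hL σ) w₀ R lo hi j),
      ¬ IsNear G (runY φ c₀ nL hL σ) (lo - (j : Site 2)) (hi + (j : Site 2)) P w₀ R x →
      ctY G (runY φ c₀ nL hL σ) w₀ R (lo - (j : Site 2)) (hi + (j : Site 2)) x ∈ T)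
    (hnear' : ∀ x ∈ outerBoundary (winGraph G w₀ R) (winLevel G (runY φ c₀ nL hL σ) w₀ R lo hi j),
      IsNear G (runY φ c₀ nL hL σ) (lo - (j : Site 2)) (hi + (j : Site 2)) P w₀ R x →
      (∃ u ∈ ctFace G (runYSideU (φ := φ) c₀ hnL hL hσ (lo - (j : Site 2)) (hi + (j : Site 2))) Rg P w₀ R x, u ∈ T) ∨
      (1 - δ ^ 2 < (bondPercolation G q).real
          (UniqZone.zone G (Λc (ctCtr G (runYSideU (φ := φ) c₀ hnL hL hσ (lo - (j : Site 2)) (hi + (j : Site 2))) P w₀ R x)) kz nz) ∧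
        1 - δ ^ 2 < (bondPercolation G q).real
          (linkIn (↑(Rg (ctCtr G (runYSideU (φ := φ) c₀ hnL hL hσ (lo - (j : Site 2)) (hi + (j : Site 2))) P w₀ R x)) : Set V)
            (Λc (ctCtr G (runYSideU (φ := φ) c₀ hnL hL hσ (lo - (j : Site 2)) (hi + (j : Site 2))) P w₀ R x) kz)
            (pexY G φ Q σ (ctDir G (runY φ c₀ nL hL σ) w₀ R (lo - (j : Site 2)) (hi + (j : Site 2)) x).1
              (ctDir G (runY φ c₀ nL hL σ) w₀ R (lo - (j : Site 2)) (hi + (j : Site 2)) x).2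
              (ctCtr G (runYSideU (φ := φ) c₀ hnL hL hσ (lo - (j : Site 2)) (hi + (j : Site 2))) P w₀ R x))) ∧
        ∃ Qt Ft : Finset V, Ft ⊆ T ∧ Qt ⊆ D ∧
          Disjoint Ft (Λc (ctCtr G (runYSideU (φ := φ) c₀ hnL hL hσ (lo - (j : Site 2)) (hi + (j : Site 2))) P w₀ R x) nz) ∧
          1 - δ ^ 2 < (prodBernoulli Wt).real (linkIn (↑Qt : Set V)
            (Λc (ctCtr G (runYSideU (φ := φ) c₀ hnL hL hσ (lo - (j : Site 2)) (hi + (j : Site 2))) P w₀ R x) kz) Ft))) :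
    ∃ (σ' : SData V) (S : Finset V), SHyp (winLData G (runY φ c₀ nL hL σ) w₀ R lo hi o Sfin) j σ' ∧ σ'.N ≤ N ∧
      (1 - (q : ℝ) ^ σ'.sB) ^ σ'.k ≤ δ ∧ S ⊆ (winLData G (runY φ c₀ nL hL σ) w₀ R lo hi o Sfin).X j ∧ S ⊆ D ∧
      (∀ x ∈ σ'.K, ∀ e ∈ σ'.seed x, e ∉ wireSet (↑S : Set V)) ∧ (∀ x ∈ σ'.K, σ'.face x ⊆ S) ∧
      (∀ x ∈ σ'.K, 1 - 3 * δ ≤ (prodBernoulli Wt).real {ω | ∃ u ∈ σ'.face x,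
        1 - δ < (prodBernoulli (pinW Wt (wireSet (↑S : Set V)) ω)).real (⋃ t ∈ T, openConnIn (↑D : Set V) u t)}) := by
  set SF := runYSideU (φ := φ) c₀ hnL hL hσ (lo - (j : Site 2)) (hi + (j : Site 2)) with hSF
  have hU1 : (1 : ℤ) ≤ (shearUnit nL hL : ℤ) := by have := shearUnit_pos hnL hL; omega
  have hU : (shearUnit nL hL : ℤ) ≤ ((kq + 1 : ℕ) : ℤ) * nL := by
    unfold shearUnit; push_cast
    have : (hL.natAbs : ℤ) ≤ kq * nL := by exact_mod_cast hκL
    linarith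
  have haff : ∀ (i : Fin 2) (σ₀ : ℤˣ), (SF i σ₀).IsAffine (shearUnit nL hL : ℤ) (if i = 0 then (nL : ℤ) else (shearUnit nL hL : ℤ)) := fun i σ₀ => by
    rw [hSF]; exact runYSideU_isAffine c₀ hnL hL hσ _ _ i σ₀
  have hC : ∀ (i : Fin 2) (σ₀ : ℤˣ), (nL : ℤ) ≤ (if i = 0 then (nL : ℤ) else (shearUnit nL hL : ℤ)) := fun i σ₀ => by
    split_ifs
    · exact le_rfl
    · have : ((shearUnit nL hL : ℕ) : ℤ) = nL + (hL.natAbs : ℤ) := by unfold shearUnit; push_cast; ring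
      rw [this]; linarith [Int.natCast_nonneg hL.natAbs]
  have hA0 : 0 ≤ P.A := by rw [hA]; positivity
  have hdD : P.d + 2 ≤ shellD P := by omega
  refine kitClauseA' SF Rg (lip_runY hlipφ hσ hnL c₀ hL) ((qStepsN_runY hstep hnL c₀ hL hσ hκL).mono hPN) hlipφ hstep hfr hκ hΔ hδ hℓ
    hwide hdw hdD hDw hDρ
    (hbelow_of_affine SF haff hU1 P hD1) (habove_of_affine SF haff hU1 P hd1) (hK_of_affine SF haff hU1 P hnL hC hU hKmax)
    (fun i σ₀ z hz _ => hKC_of_affine SF haff hU1 P hnL hC hU hA hKCmax i σ₀ z hz) (hθA_of_affine SF haff hU1 P hA0 hdD) (hAz_of_affine SF haff P hA)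
    (hcap_of_affine SF haff hU1 P hD2) (compat_runY hnL c₀ hL hσ) hT hT' hW hR' hRg hRgcard hcU1 hr₀ hR hrs hcS Λc hkn hΛ
    (pexY G φ Q σ) (fun i σ₀ c v hv => ⟨hQRg i σ₀ c hv, ?_⟩) k o Sfin hWD hXD hN hk hfar hnear'
  rw [hSF]
  exact pexY_spec c₀ hnL hL hσ _ _ Q hA hnS hexRaw hexLev i σ₀ c v hv

end Skelφ

end Summit.CriticalPhenomena.PercolationContinuityZ3.Theorems.Transplant

end
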